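import Summits.BirchSwinnertonDyer.BirchSwinnertonDyer.Theses.SignedBaseChange
import Summits.BirchSwinnertonDyer.BirchSwinnertonDyer.Theorems.SignedBaseChangeAnticyclotomicEisensteinDivisibilityCoprimeSupersingularBDPMultTateTC
import Summits.BirchSwinnertonDyer.BirchSwinnertonDyer.Theorems.SignedBaseChangeTwistPairGreenbergProductDivisibilityK1AcanchorSupersingular
import HarnessLib

/-! # Skeleton `bdpline_coprime_ss` — the line `bdpline` FOR A SUPERSINGULAR, COPRIME SUCCESSOR ITEM (binders `W.frobeniusTrace p = 0`
and `¬ p ∣ h_K`), CANDIDATE (width seat bsd-line-sbc-p1-w2 gen 11, 2026-08-28; NOT registered on anything — the ADD is the planner's verb,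
the registration the lead's)

**v4 (lead bsd-line-sbc-p1 gen 14, 2026-08-29) = v3 re-run against the v37 texts of `Lines/bdpline.lean` (b5384330c4ca9c58):** EVENT
p681302 (cell `bsd-eis`: Harari Thm. 17.13 (a) PROVED at totally complex fields) ⇒ `stub_namedFactsSS` below = v37's `stub_namedFactsSS` minus
the Yan–Zhu triple — SEVEN conjuncts: the Poitou–Tate conjunct is GONE and Tate's global Euler characteristic is carried only at totally
complex fields (`∀ K [IsTotallyComplex K], tateGlobalEulerPoincareCharacteristic K`); the composition is the lead gen 14's
`SignedBaseChangeAcDivCoprimeSupersingularBDPMultTateTC.anticyclotomicEisensteinDivisibility_ss_coprime_of_stubs_bdpmult_tateTC` (pointwise copy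
of p680714 with the finite exponent of `X_Gr₂[T₁]` read from Greenberg 2016 Prop. 4.1.1 + Tate (TC) by p683298). Research stub VERBATIM (v36 = v37
text). Still a CANDIDATE (no successor item; nothing registered on it).
**v3 (lead bsd-line-sbc-p1 gen 13, 2026-08-29) = v2 re-run against the v36 texts of `Lines/bdpline.lean` (713d5ff30b83f0e5):** the
research stub is v36's `stub_bdpLowerHalfRatSS_mult` VERBATIM (BDP currency: the rational BDP Eisenstein inclusion on cells β/γ at
`p ∤ h_K`; it REPLACES Form T `stub_signedEisensteinSS_mult` — same debt in the kernel: p649794 / p679702 + p680159 / p678685), and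
`stub_namedFactsSS` = v36's `stub_namedFactsSS` minus its first conjunct (the Yan–Zhu triple): EIGHT conjuncts = refereed ×7 (LV19 ·
CW24 proof-of-6.8 inputs · Greenberg 2016 4.1.1 + textbook roots Tate global EPC / Poitou–Tate 17.13 (a) · BCS25 ×2 · CHKLL25) + ONE
published-with-unsourced-step (BLV26 ∘ CW24, flag K1) + ZERO preprint (CW24 Lemma 6.7 and "`Sel_± = Sel^{±,rel}`" are no longer
consumed). Composition: the lead gen 13's pointwise copy `SignedBaseChangeAcDivCoprimeSupersingularBDPMult.anticyclotomicEisensteinDivisibility_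
ss_coprime_of_stubs_bdpmult` of p674687. Still a CANDIDATE: nothing is registered on it (no successor item exists; the ADD is the
planner's verb). (v2 header follows.)
**v2 (lead bsd-line-sbc-p1 gen 11, 2026-08-28) = v1 re-run against the v35 NAMED-FACTS TEXT of `Lines/bdpline.lean` (ea06c4a9262f673d):**
conjunct 8 of `stub_namedFactsSS` is the REFEREED named fact `BurungaleCastellaSkinner2025.proofProp422_span_minus_eq_span_bdp_goodReduction`
(IMRN 2025, proof of Prop. 4.2.2; typed p669772, flag `BCS-422-comparison-via-CGS`) instead of the claim-tagged preprint binder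
`BurungaleSkinnerTianWan2024.prop627_span_minus_eq_span_bdp_supersingular_PRE`; the composition is the lead gen 11's pointwise copy
`SignedBaseChangeAcDivCoprimeSupersingularMultBCS.anticyclotomicEisensteinDivisibility_ss_coprime_of_stubs_mult_bcs` (p674687) of p658866.
So `stub_namedFactsSS` below = v35's `stub_namedFactsSS` minus its first conjunct (the Yan–Zhu triple): named facts ×10 = refereed ×9
(LV19 · CW24 ×3 · Greenberg 2016 4.1.1 + textbook roots Tate global EPC / Poitou–Tate 17.13 (a) · BCS25 ×2 · CHKLL25) + ONE
published-with-unsourced-step (BLV26 ∘ CW24, flag K1) + ZERO preprint; `stub_signedEisensteinSS_mult` = v35's VERBATIM. Still a CANDIDATE: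
nothing is registered on it (no successor item exists; the ADD is the planner's verb). (v1 header follows.)

= the lead's `Lines/bdpline_coprime.lean` (v5/v6) with the ORDINARY SLICE REMOVED. Rationale: the only consumer of the crux
`AnticyclotomicEisensteinDivisibility` (stmt-BirchSwinnertonDyer-20727) — the K1″ glue of line `acanchor` — instantiates it on class-X7
pairs (`a_p = 0` at `p ≥ 5`) and their twists (`a_p(W^{(d)}) = (d/p)·a_p(W) = 0`), so a successor item may carry the binder
`W.frobeniusTrace p = 0 →` (position: after `W.HasGoodReductionAtPrime p →`, byte-parity with the K3 twin `SmallImageAcDivRat`); the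
K1″ glue for that text is LANDED (`SignedBaseChangeK1AcanchorSupersingular.twistPairGreenbergProductDivisibilityCanonical_of_acDivSSCoprime_
of_twoVariableEulerSystemDivisibility`, p658488: `BRR2022_thm_1 → CoprimeSS-by-name-antecedent → TwoVariableEulerSystemDivisibility → K1″`).
With the binder, the Yan–Zhu triple (Thms. 4.2 (2) / 4.7 / 3.3 — the ordinary slice `acDivChild_of_goodOrd`) leaves the named-facts
stub: v32's 14 typed facts become 11 (sources: LV19 · CW24 ×3 · BLV26∘CW24 (flag K1) · Greenberg 2016 4.1.1 · Tate global EPC ·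
Poitou–Tate 17.13 (a) · BSTW24 6.27 (i) PRE · BCS25 4.2.2 · CHKLL25 7.1/7.2). Stubs (2): `stub_namedFactsSS` (= `Lines/bdpline.lean` v32
`stub_namedFactsSS` text minus its first conjunct) · `stub_signedEisensteinSS_mult` (RESEARCH; = the lead gen 7's twice-narrowed Form T,
text of p658139's `hKoly`). Composition: `SignedBaseChangeAcDivCoprimeSupersingularMult.anticyclotomicEisensteinDivisibility_ss_coprime_of_
stubs_mult` (p658866, this seat). The ES sibling stmt-…-20728 has the same shape (`Lines/ratlift.lean` opens with the same `by_cases` on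
`p ∣ a_p`; `stub_ordSliceES` ⟸ YZ26 ×3): an `a_p = 0` twin there removes the Yan–Zhu triple from the route altogether (glue
`…_of_acanchorChildren_ss_coprimeClassNumber`, same file p658488). No summit statement / BSD is proved by this file. -/

-- D-0017: single-problem summit, the namespace repeats the problem name by design.
set_option linter.dupNamespace false
set_option autoImplicit false

noncomputable section

open scoped Classical

namespace Summit.BirchSwinnertonDyer.BirchSwinnertonDyer.Cruxes.AnticyclotomicEisensteinDivisibility.BdplineCoprimeSS

open Summit.BirchSwinnertonDyer.BirchSwinnertonDyer.Theses.SignedBaseChange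
open Literature.NumberTheory.EllipticCurves
open Summit.BirchSwinnertonDyer.BirchSwinnertonDyer.Theorems

/-- The SUPERSINGULAR COPRIME successor text (binders `W.frobeniusTrace p = 0` after `W.HasGoodReductionAtPrime p →` and
`¬ p ∣ NumberField.classNumber K` after `κ₂.IsAnticyclotomic →`), by-name antecedent. -/
def CoprimeSS : Prop :=
  SignedTwoVariableInputs → Literature.NumberTheory.EllipticCurves.ModularForms.nonempty_modularParametrizationData → ∀ (W : WeierstrassCurve ℚ) [W.IsElliptic] [W.IsGloballyMinimal] (p : ℕ) [Fact p.Prime], 5 ≤ p → W.HasGoodReductionAtPrime p → W.frobeniusTrace p = 0 → Literature.NumberTheory.EllipticCurves.Rank1Residual.Surj W p → ∀ (K : Type) [Field K] [NumberField K] (ι : PadicAlgCl p ≃+* ℂ) (v vbar : IsDedekindDomain.HeightOneSpectrum (NumberField.RingOfIntegers K)) (κ₁ κ₂ : Literature.NumberTheory.EllipticCurves.ZpExtension K p) (γ₁ γ₂ : Field.absoluteGaloisGroup K) [Fact (Literature.NumberTheory.EllipticCurves.ZpExtension.IsTopGeneratorPair κ₁ κ₂ γ₁ γ₂)] [NeZero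 (NumberField.discr K).natAbs] (N : ℕ) [NeZero N] (f : CuspForm (CongruenceSubgroup.Gamma0 N) 2), Literature.NumberTheory.EllipticCurves.ModularForms.IsNewformOf W f → (N : ℤ) = W.conductorNorm ℤ → Literature.NumberTheory.EllipticCurves.IsImaginaryQuadratic K → ((Ideal.span {(p : ℤ)}).primesOver (NumberField.RingOfIntegers K)).ncard = 2 → ((p : ℕ) : NumberField.RingOfIntegers K) ∈ v.asIdeal → ((p : ℕ) : NumberField.RingOfIntegers K) ∈ vbar.asIdeal → vbar ≠ v → (∀ (w : NumberField.InfinitePlace K) (k : NumberField.RingOfIntegers K), k ∈ v.asIdeal ↔ ‖ι.symm (w.embedding (k : K))‖ < 1) → IsCoprime (N : ℤ) (NumberField.discr K) → (∀ ℓ : ℕ, ℓ.Prime → ℓ ∣ N → ((Ideal.span {(ℓ : ℤ)}).primesOver (NumberField.RingOfIntegers K)).ncard = 2) → Odd (NumberField.discr K) → NumberField.discr K ≠ -3 → κ₁.IsCyclotomic → κ₂.IsAnticyclotomic → ¬ p ∣ NumberField.classNumber K → ∀ (Ω δ : ℂ) (Ωp : (Literature.NumberTheory.EllipticCurves.unrIntegers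 p)ˣ) (LK G : PowerSeries (PowerSeries (PadicComplexInt p))), Ω ≠ 0 → (δ ^ 2 = (NumberField.discr K : ℂ) ∨ δ ^ 2 = -(NumberField.discr K : ℂ)) → Literature.NumberTheory.EllipticCurves.IsKatzMeasure₂ ι v vbar ∅ κ₁ κ₂ γ₁⁻¹ γ₂⁻¹ 1 Ω δ ((Ωp : Literature.NumberTheory.EllipticCurves.unrIntegers p) : PadicComplex p) LK → Literature.NumberTheory.EllipticCurves.IsGreenbergLFunctionAnyRoot₂ ι v vbar κ₁ κ₂ γ₁⁻¹ γ₂⁻¹ f (NumberField.discr K).natAbs (NumberField.classNumber K) LK G → ∀ J : ℤ_[p] →+* PadicComplexInt p, (∀ x : ℤ_[p], ((J x : PadicComplexInt p) : PadicComplex p) = ((x : ℚ_[p]) : PadicComplex p)) → ((WeierstrassCurve.XGr₂.charIdeal (W.baseChange K) p κ₁ κ₂ vbar γ₁ γ₂).map (Literature.NumberTheory.EllipticCurves.IwasawaAlgebra₂.toUnr₂ p J)).map (PowerSeries.constantCoeff (R := PowerSeries (PadicComplexInt p))) ≤ Ideal.span {Literature.NumberTheory.EllipticCurves.UnrSeries₂.minus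 G}

/-- stub FACTS (v4: = `Lines/bdpline.lean` v37 `stub_namedFactsSS` WITHOUT its first conjunct, the Yan–Zhu triple — SEVEN conjuncts; no Poitou–Tate conjunct, Tate at totally complex fields). -/
theorem stub_namedFactsSS :
    (∀ (W : WeierstrassCurve ℚ) [W.IsGloballyMinimal] (K : Type) [Field K] [NumberField K] (p : ℕ) [Fact p.Prime]
      (κ : Literature.NumberTheory.EllipticCurves.ZpExtension K p) (𝔭 𝔭' : IsDedekindDomain.HeightOneSpectrum (NumberField.RingOfIntegers K)),
      Literature.NumberTheory.EllipticCurves.AcSigned.longoVigni2019_thm14_signedSelmerDual_rank_one W K p κ 𝔭 𝔭') ∧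
    (∀ (N : ℕ) [NeZero N] (W : WeierstrassCurve ℚ) [W.IsGloballyMinimal] (K : Type) [Field K] [NumberField K] (p : ℕ) [Fact p.Prime]
      (κ : Literature.NumberTheory.EllipticCurves.ZpExtension K p) (𝔭 𝔭' : IsDedekindDomain.HeightOneSpectrum (NumberField.RingOfIntegers K)),
      Literature.NumberTheory.EllipticCurves.AcSigned.castellaWan2024_proofThm68_transferInputs N W K p κ 𝔭 𝔭') ∧
    Literature.NumberTheory.EllipticCurves.BertoliniLongoVenerucci2026.thmA_castellaWan_thm68_exists_isCWBDPLFunction_charIdeal_map_le_rat ∧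
    (Literature.NumberTheory.IwasawaTheory.Greenberg2016.prop411_selmer_isAlmostDivisible ∧
      (∀ (K : Type) [Field K] [NumberField K] [NumberField.IsTotallyComplex K], Literature.NumberTheory.GaloisCohomology.tateGlobalEulerPoincareCharacteristic K)) ∧
    Literature.NumberTheory.EllipticCurves.BurungaleCastellaSkinner2025.proofProp422_span_minus_eq_span_bdp_goodReduction ∧
    Literature.NumberTheory.EllipticCurves.BurungaleCastellaSkinner2025.prop422_exists_isBDPLFunction_mu_eq_zero ∧
    Literature.NumberTheory.EllipticCurves.CastellaHsuKunduLeeLiu2025.thm71_cor72_exists_isCWBDPLFunction_charIdeal_map_le_rat := by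
  sorry

/-- stub S1-rat-mult (RESEARCH; = `Lines/bdpline.lean` v36 `stub_bdpLowerHalfRatSS_mult` VERBATIM: the rational BDP Eisenstein inclusion at a good supersingular `p ≥ 5` on cells β/γ, `p ∤ h_K`). -/
theorem stub_bdpLowerHalfRatSS_mult :
    SignedTwoVariableInputs → Literature.NumberTheory.EllipticCurves.ModularForms.nonempty_modularParametrizationData → ∀ (W : WeierstrassCurve ℚ) [W.IsElliptic] [W.IsGloballyMinimal] (p : ℕ) [Fact p.Prime], 5 ≤ p → W.HasGoodReductionAtPrime p → W.frobeniusTrace p = 0 → Literature.NumberTheory.EllipticCurves.Rank1Residual.Surj W p → ∀ (K : Type) [Field K] [NumberField K] (ι : PadicAlgCl p ≃+* ℂ) (v vbar : IsDedekindDomain.HeightOneSpectrum (NumberField.RingOfIntegers K)) (κ₁ κ₂ : Literature.NumberTheory.EllipticCurves.ZpExtension K p) (γ₁ γ₂ : Field.absoluteGaloisGroup K) [Fact (Literature.NumberTheory.EllipticCurves.ZpExtension.IsTopGeneratorPair κ₁ κ₂ γ₁ γ₂)] [NeZero (NumberField.discr K).natAbs] (N : ℕ) [NeZero N] (f : CuspForm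 (CongruenceSubgroup.Gamma0 N) 2), Literature.NumberTheory.EllipticCurves.ModularForms.IsNewformOf W f → (N : ℤ) = W.conductorNorm ℤ → Literature.NumberTheory.EllipticCurves.IsImaginaryQuadratic K → ¬ p ∣ NumberField.classNumber K → ¬ (Squarefree N ∧ ∀ q : ℕ, q.Prime → q ∣ N → ∃ v' : IsDedekindDomain.HeightOneSpectrum (NumberField.RingOfIntegers ℚ), ((q : ℕ) : NumberField.RingOfIntegers ℚ) ∈ v'.asIdeal ∧ ∃ 𝔓 ∈ v'.primesAbove, ∃ σ ∈ 𝔓.inertia (Field.absoluteGaloisGroup ℚ), ∃ P : W.geomTorsion (p : ℤ), σ • P ≠ P) → ¬ (∀ ℓ : ℕ, ℓ.Prime → ℓ ∣ N → ℓ ^ 2 ∣ N) → ((Ideal.span {(p : ℤ)}).primesOver (NumberField.RingOfIntegers K)).ncard = 2 → ((p : ℕ) : NumberField.RingOfIntegers K) ∈ v.asIdeal → ((p : ℕ) : NumberField.RingOfIntegers K) ∈ vbar.asIdeal → vbar ≠ v → (∀ (w : NumberField.InfinitePlace K) (k : NumberField.RingOfIntegers K), k ∈ v.asIdeal ↔ ‖ι.symm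 (w.embedding (k : K))‖ < 1) → IsCoprime (N : ℤ) (NumberField.discr K) → (∀ ℓ : ℕ, ℓ.Prime → ℓ ∣ N → ((Ideal.span {(ℓ : ℤ)}).primesOver (NumberField.RingOfIntegers K)).ncard = 2) → Odd (NumberField.discr K) → NumberField.discr K ≠ -3 → κ₁.IsCyclotomic → κ₂.IsAnticyclotomic → (haveI : Fact (κ₂.IsTopGenerator γ₂) := ⟨Literature.NumberTheory.EllipticCurves.YanZhu2026.isTopGenerator_of_pair (κ₁ := κ₁) (γ₁ := γ₁)⟩; Module.IsTorsion (Literature.NumberTheory.EllipticCurves.IwasawaAlgebra p) (Literature.NumberTheory.EllipticCurves.Castella2018.AcSelmer.XAc (W.baseChange K) p κ₂ vbar ∅ γ₂)) → ∀ (ΩK : ℂ) (Ωp' : (Literature.NumberTheory.EllipticCurves.unrIntegers p)ˣ) (L : Literature.NumberTheory.EllipticCurves.UnrSeries p), ΩK ≠ 0 → Literature.NumberTheory.EllipticCurves.IsBDPLFunction ι v κ₂ γ₂ f ΩK ((Ωp' : Literature.NumberTheory.EllipticCurves.unrIntegers p) : PadicComplex p) L → ∀ J : ℤ_[p] →+*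 PadicComplexInt p, (∀ x : ℤ_[p], ((J x : PadicComplexInt p) : PadicComplex p) = ((x : ℚ_[p]) : PadicComplex p)) → ∀ (J₀ : Literature.NumberTheory.EllipticCurves.unrIntegers p →+* PadicComplexInt p), (∀ x : Literature.NumberTheory.EllipticCurves.unrIntegers p, ((J₀ x : PadicComplexInt p) : PadicComplex p) = (x : PadicComplex p)) → ∃ k : ℕ, ∀ y ∈ (haveI : Fact (κ₂.IsTopGenerator γ₂) := ⟨Literature.NumberTheory.EllipticCurves.YanZhu2026.isTopGenerator_of_pair (κ₁ := κ₁) (γ₁ := γ₁)⟩; Literature.NumberTheory.EllipticCurves.Castella2018.AcSelmer.XAc.charIdeal (W.baseChange K) p κ₂ vbar ∅ γ₂).map (PowerSeries.map J), PowerSeries.C (((p : ℕ) : PadicComplexInt p) ^ k) * y ∈ Ideal.span {PowerSeries.map J₀ L} := by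
  sorry

/-! ## The composition: the successor text BY NAME -/

/-- `CoprimeSS` from the two stubs (v3: the lead gen 13's v36-currency copy of p674687). -/
theorem coprimeSS_of : CoprimeSS :=
  SignedBaseChangeAcDivCoprimeSupersingularBDPMultTateTC.anticyclotomicEisensteinDivisibility_ss_coprime_of_stubs_bdpmult_tateTC
    stub_namedFactsSS stub_bdpLowerHalfRatSS_mult

/-- K1″ from `CoprimeSS`, the REGISTERED Euler-system sibling BY NAME and Beckwith–Raum–Richter 2022 Thm. 1 (p658488) — the
`--closes`-shape certificate for the planner's ADD. -/
theorem twistPairGreenbergProductDivisibilityCanonical_of_coprimeSS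
    (h22 : Literature.NumberTheory.QuadraticFields.BRR2022_thm_1) (hES : TwoVariableEulerSystemDivisibility) :
    TwistPairGreenbergProductDivisibilityCanonical :=
  SignedBaseChangeK1AcanchorSupersingular.twistPairGreenbergProductDivisibilityCanonical_of_acDivSSCoprime_of_twoVariableEulerSystemDivisibility
    h22 coprimeSS_of hES

end Summit.BirchSwinnertonDyer.BirchSwinnertonDyer.Cruxes.AnticyclotomicEisensteinDivisibility.BdplineCoprimeSS

end
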